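import Literature.RepresentationTheory.Virasoro.VermaModuleTorsionFree

/-!
# Uniqueness of singular vectors in Verma modules over the Virasoro algebra

**Iohara–Koga Proposition 5.1**: for `n ≥ 1` the space of singular vectors (vectors killed by
`Vir⁺`) of level `n` in the Verma module `V(c,h)` is at most one-dimensional; more precisely a
non-zero singular vector of level `n` has a non-zero coefficient on the PBW monomial
`L_{-1}ⁿ v_{c,h}` (`Verma.singular_not_mem_span_ne_ones`), so that two singular vectors of the
same level are proportional (`Verma.exists_smul_eq_of_singular`) and the submodule generated by
all primary vectors of weight `h + n` is generated by any non-zero one of them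
(`Verma.primarySpan_eq_generated`).

## The proof (Iohara–Koga Lemma 5.15, "triangularity")

Filter `V(c,h)_{h+N}` by the number of letters `L_{-1}` in the PBW monomials
(`VirasoroRep.onesSpace`). Then (for every representation and vector)
* prepending `L_{-k}` and straightening does not create letters `L_{-1}` beyond the prepended one
  (`VirasoroRep.L_neg_pbwVector_sub_mem_onesSpace`);
* (Verma module) a raising operator `L_m`, `m ≥ 1`, creates at most one `L_{-1}`
  (`Verma.L_pos_mem_onesSpace`, Iohara–Koga Lemma 5.15 Step I), none on `L_{-1}ʲ v`
  (`Verma.L_pos_pbwVector_ones_mem`);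
* if all letters `≠ 1` of an ordered word `l` are `≥ a ≥ 2`, then modulo words with at most as many
  `L_{-1}` as `l`, `L_{a-1} e_l v ≡ r_a (2a - 1) e_{l'} v` where `r_a` is the multiplicity of `a` in
  `l` and `l'` is `l` with one `a` replaced by `1` (`Verma.L_pred_pbwVector_sub_mem`,
  Iohara–Koga Lemma 5.15 Step III: `[L_{a-1}, L_{-a}] = (2a-1) L_{-1}`).
Now let `w` be singular of level `n ≥ 1` with vanishing `L_{-1}ⁿ`-coefficient; let `k₀` be the
largest number of `1`'s among the monomials of `w` and `a` the least part `≠ 1` among the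
monomials with `k₀` ones. Reading `L_{a-1} w = 0` modulo at most `k₀` ones kills the coefficient of
a monomial containing `a` — a contradiction (PBW independence).
-/

noncomputable section

namespace Literature.RepresentationTheory.Virasoro

namespace VirasoroRep

variable {c : ℂ} {V : Type*} [AddCommGroup V] [Module ℂ V] (R : VirasoroRep c V)

/-! ### The filtration by the number of `L_{-1}` -/

/-- The span of the ordered words `L_{-k₁} ⋯ L_{-k_j} w` (`k₁ ≥ ⋯ ≥ k_j ≥ 1`, `Σ kᵢ = N`) with at
most `r` letters equal to `1` (Iohara–Koga's `max_{L_{-1}} ≤ r`). [cite: IoharaKoga2011, Lemma 5.15 (proof, the function max_{L_{-1}})] -/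
def onesSpace (w : V) (N r : ℕ) : Submodule ℂ V :=
  Submodule.span ℂ {x | ∃ l : List ℕ, l.Pairwise (· ≥ ·) ∧ (∀ k ∈ l, 0 < k) ∧ l.sum = N ∧
    l.count 1 ≤ r ∧ x = R.pbwVector l w}

/-- Ordered words with at most `r` ones lie in `onesSpace w N r`. [folklore] -/
theorem pbwVector_mem_onesSpace (w : V) {l : List ℕ} (hs : l.Pairwise (· ≥ ·)) (hp : ∀ k ∈ l, 0 < k)
    {r : ℕ} (hr : l.count 1 ≤ r) : R.pbwVector l w ∈ R.onesSpace w l.sum r :=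
  Submodule.subset_span ⟨l, hs, hp, rfl, hr, rfl⟩

/-- The filtration is increasing. [folklore] -/
theorem onesSpace_mono (w : V) (N : ℕ) {r r' : ℕ} (h : r ≤ r') : R.onesSpace w N r ≤ R.onesSpace w N r' :=
  Submodule.span_mono fun _ ⟨l, hs, hp, hsum, hr, hx⟩ => ⟨l, hs, hp, hsum, hr.trans h, hx⟩

/-- The filtration lies in the level space. [folklore] -/
theorem onesSpace_le_levelSpace (w : V) (N r : ℕ) : R.onesSpace w N r ≤ R.levelSpace w N := by
  refine Submodule.span_le.mpr ?_
  rintro _ ⟨l, hs, hp, rfl, -, rfl⟩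
  exact R.pbwVector_mem_levelSpace w hs hp

/-- Inserting `k` in order adds a one iff `k = 1`. [folklore] -/
theorem count_one_orderedInsert (l : List ℕ) (k : ℕ) :
    (l.orderedInsert (· ≥ ·) k).count 1 = l.count 1 + if k = 1 then 1 else 0 := by
  rw [(List.perm_orderedInsert (· ≥ ·) k l).count_eq, List.count_cons]
  by_cases hk : k = 1
  · subst hk; simp
  · simp [hk]

/-- **Straightening does not create `L_{-1}`.** For every vector `w`, level `N` and `k ≥ 1`:
(A) for a decreasing positive word `l` of sum `N`, `L_{-k} e_l w - e_{l'} w` (`l'` = `l` with `k`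
inserted in order) lies in the span of the ordered words of level `N + k` with at most as many
ones as `l`; (B) `L_{-k}` maps `onesSpace w N r` into `onesSpace w (N+k) (r + [k = 1])`.
[cite: IoharaKoga2011, Lemma 5.15 (proof, Step II)] -/
theorem L_neg_pbwVector_sub_mem_onesSpace (w : V) (N : ℕ) :
    (∀ l : List ℕ, l.Pairwise (· ≥ ·) → (∀ k ∈ l, 0 < k) → l.sum = N → ∀ k : ℕ, 0 < k →
      R.L (-(k : ℤ)) (R.pbwVector l w) - R.pbwVector (l.orderedInsert (· ≥ ·) k) w ∈
        R.onesSpace w (N + k) (l.count 1)) ∧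
    (∀ k : ℕ, 0 < k → ∀ r : ℕ, ∀ x ∈ R.onesSpace w N r,
      R.L (-(k : ℤ)) x ∈ R.onesSpace w (N + k) (r + if k = 1 then 1 else 0)) := by
  induction N using Nat.strong_induction_on with
  | _ N ih =>
  have hA : ∀ l : List ℕ, l.Pairwise (· ≥ ·) → (∀ k ∈ l, 0 < k) → l.sum = N → ∀ k : ℕ, 0 < k →
      R.L (-(k : ℤ)) (R.pbwVector l w) - R.pbwVector (l.orderedInsert (· ≥ ·) k) w ∈
        R.onesSpace w (N + k) (l.count 1) := by
    intro l hs hp hsum k hk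
    subst hsum
    cases l with
    | nil => simp
    | cons a l =>
      rw [List.pairwise_cons] at hs
      rw [List.orderedInsert_cons]
      by_cases hka : k ≥ a
      · rw [if_pos hka, R.pbwVector_cons k, sub_self]
        exact zero_mem _
      · rw [if_neg hka]
        have hka' : k < a := Nat.lt_of_not_le hka
        have ha : 0 < a := hp a List.mem_cons_self
        have ha1 : a ≠ 1 := by omega
        have hp' : ∀ j ∈ l, 0 < j := fun j hj => hp j (List.mem_cons_of_mem a hj)
        set y := R.pbwVector l w with hy_def
        have hlt : l.sum < (a :: l).sum := by rw [List.sum_cons]; omega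
        have hlt' : l.sum + k < (a :: l).sum := by rw [List.sum_cons]; omega
        have hcount : (a :: l).count 1 = l.count 1 := by
          rw [List.count_cons]; simp [ha1]
        have h1 : R.L (-(k : ℤ)) y - R.pbwVector (l.orderedInsert (· ≥ ·) k) w ∈
            R.onesSpace w (l.sum + k) (l.count 1) := (ih _ hlt).1 l hs.2 hp' rfl k hk
        have h2 : R.L (-(a : ℤ)) (R.L (-(k : ℤ)) y - R.pbwVector (l.orderedInsert (· ≥ ·) k) w) ∈
            R.onesSpace w (l.sum + k + a) (l.count 1 + if a = 1 then 1 else 0) :=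
          (ih _ hlt').2 a ha _ _ h1
        have h3 : R.L (-((k + a : ℕ) : ℤ)) y ∈
            R.onesSpace w (l.sum + (k + a)) (l.count 1 + if k + a = 1 then 1 else 0) :=
          (ih _ hlt).2 (k + a) (by omega) _ _ (R.pbwVector_mem_onesSpace w hs.2 hp' le_rfl)
        rw [if_neg ha1, add_zero] at h2
        rw [if_neg (by omega : k + a ≠ 1), add_zero] at h3
        rw [pbwVector_cons, pbwVector_cons, R.comm_apply (-(k : ℤ)) (-(a : ℤ)) y,
          centralTerm_of_ne c (by omega : -(k : ℤ) + -(a : ℤ) ≠ 0), zero_smul, add_zero,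
          show R.L (-(a : ℤ)) (R.L (-(k : ℤ)) y) + ((((-(k : ℤ) : ℤ)) : ℂ) - (((-(a : ℤ) : ℤ)) : ℂ)) •
              R.L (-(k : ℤ) + -(a : ℤ)) y - R.L (-(a : ℤ)) (R.pbwVector (l.orderedInsert (· ≥ ·) k) w) =
            R.L (-(a : ℤ)) (R.L (-(k : ℤ)) y - R.pbwVector (l.orderedInsert (· ≥ ·) k) w) +
              ((((-(k : ℤ) : ℤ)) : ℂ) - (((-(a : ℤ) : ℤ)) : ℂ)) • R.L (-(k : ℤ) + -(a : ℤ)) y by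
            rw [map_sub]; abel]
        have e1 : l.sum + k + a = (a :: l).sum + k := by rw [List.sum_cons]; omega
        have e2 : l.sum + (k + a) = (a :: l).sum + k := by rw [List.sum_cons]; omega
        have e3 : -(k : ℤ) + -(a : ℤ) = -((k + a : ℕ) : ℤ) := by push_cast; ring
        rw [e1] at h2
        rw [e2] at h3
        rw [e3, hcount]
        exact add_mem h2 (Submodule.smul_mem _ _ h3)
  refine ⟨hA, fun k hk r x hx => ?_⟩
  induction hx using Submodule.span_induction with
  | mem x hx =>
    obtain ⟨l, hs, hp, hsum, hr, rfl⟩ := hx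
    obtain ⟨hs', hp', hsum', -⟩ := orderedInsert_props hs hp hk
    have h1 := R.onesSpace_mono w (N + k) (show l.count 1 ≤ r + (if k = 1 then 1 else 0) by omega)
      (hA l hs hp hsum k hk)
    have h2 : R.pbwVector (l.orderedInsert (· ≥ ·) k) w ∈
        R.onesSpace w (N + k) (r + if k = 1 then 1 else 0) := by
      have := R.pbwVector_mem_onesSpace w hs' hp' (r := r + if k = 1 then 1 else 0)
        (by rw [count_one_orderedInsert]; split_ifs <;> omega)
      rwa [hsum', hsum] at this
    have := add_mem h1 h2
    rwa [sub_add_cancel] at this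
  | zero => rw [map_zero]; exact zero_mem _
  | add x y _ _ hx hy => rw [map_add]; exact add_mem hx hy
  | smul a x _ hx => rw [map_smul]; exact Submodule.smul_mem _ a hx

/-- **`Vir⁺` is generated by `L_1` and `L_2`**: a vector killed by `L_1` and `L_2` is killed by all
`L_m`, `m ≥ 1` (`(m-1) L_{m+1} = L_m L_1 - L_1 L_m`). [cite: IoharaKoga2011, Lemma 5.15 (proof: "Since L_{j-1}.w = 0 for any j > 1") and §1.2.3] -/
theorem annihilated_iff_L_one_L_two (w : V) :
    (∀ m : ℕ, 1 ≤ m → R.L m w = 0) ↔ R.L 1 w = 0 ∧ R.L 2 w = 0 := by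
  refine ⟨fun h => ⟨h 1 le_rfl, h 2 (by norm_num)⟩, fun ⟨h1, h2⟩ m hm => ?_⟩
  induction m using Nat.strong_induction_on with
  | _ m ih =>
    rcases Nat.lt_or_ge m 3 with hm3 | hm3
    · interval_cases m
      · exact_mod_cast h1
      · exact_mod_cast h2
    · -- `(m - 2) L_m w = L_{m-1} L_1 w - L_1 L_{m-1} w = 0`
      have hrel := R.lie ((m - 1 : ℕ) : ℤ) 1 w
      rw [show (1 : ℤ) = ((1 : ℕ) : ℤ) by norm_num, ih 1 (by omega) le_rfl, map_zero,
        ih (m - 1) (by omega) (by omega), map_zero, sub_zero,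
        centralTerm_of_ne c (by omega), zero_smul, add_zero,
        show ((m - 1 : ℕ) : ℤ) + ((1 : ℕ) : ℤ) = ((m : ℕ) : ℤ) by omega] at hrel
      have hcoef : ((((m - 1 : ℕ) : ℤ) : ℂ) - (((1 : ℕ) : ℤ) : ℂ)) ≠ 0 := by
        have : ((((m - 1 : ℕ) : ℤ) : ℂ) - (((1 : ℕ) : ℤ) : ℂ)) = ((m - 2 : ℕ) : ℂ) := by
          push_cast [Nat.cast_sub (show 1 ≤ m by omega), Nat.cast_sub (show 2 ≤ m by omega)]; ring
        rw [this]
        exact_mod_cast (show m - 2 ≠ 0 by omega)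
      exact (smul_eq_zero.mp hrel.symm).resolve_left hcoef

end VirasoroRep

/-! ### Raising operators on the Verma module create at most one `L_{-1}` -/

namespace Verma

variable {c h : ℂ}

/-- A raising operator `L_m` kills the level spaces of level `< m`. [cite: IoharaKoga2011, §4.4.1 (M(c,h) = ⊕ M(c,h)_{h+n}, n ≥ 0)] -/
theorem L_pos_apply_eq_zero_of_lt {N m : ℕ} (hNm : N < m) {x : Verma c h}
    (hx : x ∈ (rep c h).levelSpace (hw c h) N) : (rep c h).L m x = 0 := by
  have hx' : x ∈ (rep c h).weightSpace (h + N) :=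
    (rep c h).levelSpace_le_weightSpace isPrimary_hw.mem_weightSpace N hx
  have h1 := (rep c h).apply_mem_eigenspace hx' m
  have h2 : (rep c h).genWeightSpace (h + N - m) = ⊥ := by
    refine (rep c h).genWeightSpace_eq_bot isPrimary_hw generated_hw_eq_top fun N' hN' => ?_
    have : (N' : ℂ) + m = N := by linear_combination hN'
    have : N' + m = N := by exact_mod_cast this
    omega
  have h3 : (rep c h).L m x ∈ (rep c h).genWeightSpace (h + N - m) :=
    Module.End.eigenspace_le_maxGenEigenspace h1
  rw [h2, Submodule.mem_bot] at h3
  exact h3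

/-- `L_0` acts on `onesSpace v N r` by the scalar `h + N`. [folklore] -/
theorem L_zero_apply_of_mem_onesSpace {N r : ℕ} {x : Verma c h}
    (hx : x ∈ (rep c h).onesSpace (hw c h) N r) : (rep c h).L 0 x = (h + N) • x :=
  (rep c h).L_zero_apply_of_mem_levelSpace isPrimary_hw.mem_weightSpace
    ((rep c h).onesSpace_le_levelSpace (hw c h) N r hx)

/-- `[L_m, L_{-1}]` has no central term. [folklore] -/
theorem centralTerm_neg_one_right (c : ℂ) (m : ℤ) : centralTerm c m (-1) = 0 := by
  by_cases hm : m = 1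
  · subst hm; exact centralTerm_one_left c (-1)
  · exact centralTerm_of_ne c (by omega)

/-- **Raising operators on `L_{-1}ʲ v` lose an `L_{-1}`**: `L_m L_{-1}ʲ v_{c,h}` (`m ≥ 1`,
`j = M + m`) is a combination of ordered words of level `M` with at most `j - 1` ones (the modes
`L_m, L_{m-1}, …, L_0` never become negative). [cite: IoharaKoga2011, Lemma 5.15 (proof, Step II)] -/
theorem L_pos_pbwVector_ones_mem (j : ℕ) :
    ∀ M m : ℕ, 1 ≤ m → j = M + m →
      (rep c h).L m ((rep c h).pbwVector (List.replicate j 1) (hw c h)) ∈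
        (rep c h).onesSpace (hw c h) M (j - 1) := by
  induction j with
  | zero => intro M m hm hj; omega
  | succ j ih =>
    intro M m hm hj
    set R := rep c h
    set v := hw c h
    set y := R.pbwVector (List.replicate j 1) v with hy
    have hyones : y ∈ R.onesSpace v j j := by
      have := R.pbwVector_mem_onesSpace v (l := List.replicate j 1)
        (List.pairwise_replicate.mpr (Or.inr le_rfl)) (by simp) (r := j) (by simp)
      simpa using this
    have hylevel : y ∈ R.levelSpace v j := R.onesSpace_le_levelSpace v j j hyones
    rw [List.replicate_succ, VirasoroRep.pbwVector_cons, Nat.cast_one,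
      R.comm_apply m (-1) y, centralTerm_neg_one_right, zero_smul', add_zero, Nat.add_sub_cancel]
    refine add_mem ?_ (Submodule.smul_mem _ _ ?_)
    · -- `L_{-1} (L_m y)`
      by_cases hmj : m ≤ j
      · have h1 := ih (j - m) m hm (by omega)
        have h2 := (R.L_neg_pbwVector_sub_mem_onesSpace v (j - m)).2 1 one_pos _ _ h1
        rw [if_pos rfl] at h2
        have e1 : j - m + 1 = M := by omega
        have e2 : j - 1 + 1 = j := by omega
        rw [e1, e2] at h2
        exact_mod_cast h2
      · rw [L_pos_apply_eq_zero_of_lt (by omega) hylevel, map_zero]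
        exact zero_mem _
    · -- `L_{m-1} y`
      rcases eq_or_lt_of_le hm with h1 | hm1
      · -- `m = 1`: `L_0 y = (h + j) y`
        subst h1
        rw [show ((1 : ℕ) : ℤ) + -1 = 0 by ring, L_zero_apply_of_mem_onesSpace hyones]
        have hM : M = j := by omega
        subst hM
        exact Submodule.smul_mem _ _ hyones
      · have h1 := ih M (m - 1) (by omega) (by omega)
        have e : (m : ℤ) + -1 = ((m - 1 : ℕ) : ℤ) := by omega
        rw [e]
        exact R.onesSpace_mono v M (by omega) h1

/-- **Raising operators create at most one `L_{-1}`** (Iohara–Koga Lemma 5.15, Step I: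
`max_{L_{-1}}(L_m e_𝕀 v) ≤ r₁ + 1`): `L_m`, `m ≥ 1`, maps `onesSpace v (M+m) r` into
`onesSpace v M (r+1)`. [cite: IoharaKoga2011, Lemma 5.15 (proof, Step I)] -/
theorem L_pos_mem_onesSpace (N : ℕ) :
    ∀ M m r : ℕ, 1 ≤ m → M + m = N → ∀ x ∈ (rep c h).onesSpace (hw c h) N r,
      (rep c h).L m x ∈ (rep c h).onesSpace (hw c h) M (r + 1) := by
  induction N using Nat.strong_induction_on with
  | _ N ih =>
  intro M m r hm hMN x hx
  set R := rep c h
  set v := hw c h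
  induction hx using Submodule.span_induction with
  | mem x hx =>
    obtain ⟨l, hs, hp, hsum, hr, rfl⟩ := hx
    cases l with
    | nil => simp at hsum; omega
    | cons a l =>
      rw [List.pairwise_cons] at hs
      have ha : 0 < a := hp a List.mem_cons_self
      have hp' : ∀ j ∈ l, 0 < j := fun j hj => hp j (List.mem_cons_of_mem a hj)
      rw [List.sum_cons] at hsum
      set y := R.pbwVector l v with hy
      have hyones : y ∈ R.onesSpace v l.sum (l.count 1) := R.pbwVector_mem_onesSpace v hs.2 hp' le_rfl
      have hylevel : y ∈ R.levelSpace v l.sum := R.onesSpace_le_levelSpace v _ _ hyones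
      have hcount : l.count 1 ≤ r := by
        rw [List.count_cons] at hr; split_ifs at hr <;> omega
      have hcount' : l.count 1 + (if a = 1 then 1 else 0) ≤ r := by
        rw [List.count_cons] at hr
        by_cases ha1 : a = 1
        · subst ha1; simp at hr; simp; omega
        · simp [ha1] at hr ⊢; exact hr
      rw [VirasoroRep.pbwVector_cons, R.comm_apply m (-(a : ℤ)) y]
      have hT1 : R.L (-(a : ℤ)) (R.L m y) ∈ R.onesSpace v M (r + 1) := by
        by_cases hml : m ≤ l.sum
        · have h1 := ih l.sum (by omega) (l.sum - m) m (l.count 1) hm (by omega) y hyones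
          have h2 := (R.L_neg_pbwVector_sub_mem_onesSpace v (l.sum - m)).2 a ha _ _ h1
          have e1 : l.sum - m + a = M := by omega
          rw [e1] at h2
          exact R.onesSpace_mono v M (by omega) h2
        · rw [L_pos_apply_eq_zero_of_lt (by omega) hylevel, map_zero]
          exact zero_mem _
      have hT2 : R.L ((m : ℤ) + -(a : ℤ)) y ∈ R.onesSpace v M (r + 1) := by
        rcases lt_trichotomy m a with hma | rfl | hma
        · -- `m < a`: a creation operator `L_{-(a-m)}`
          have h1 := (R.L_neg_pbwVector_sub_mem_onesSpace v l.sum).2 (a - m) (by omega) _ _ hyones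
          have e1 : (m : ℤ) + -(a : ℤ) = -((a - m : ℕ) : ℤ) := by omega
          have e2 : l.sum + (a - m) = M := by omega
          rw [e1]
          rw [e2] at h1
          refine R.onesSpace_mono v M ?_ h1
          split_ifs <;> omega
        · -- `m = a`: `L_0 y`
          rw [show (m : ℤ) + -(m : ℤ) = 0 by ring, L_zero_apply_of_mem_onesSpace hyones]
          have hM : l.sum = M := by omega
          rw [hM] at hyones
          exact Submodule.smul_mem _ _ (R.onesSpace_mono v M (by omega) hyones)
        · -- `m > a`: a raising operator `L_{m-a}` on a lower level
          have e1 : (m : ℤ) + -(a : ℤ) = ((m - a : ℕ) : ℤ) := by omega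
          rw [e1]
          have h1 := ih l.sum (by omega) M (m - a) (l.count 1) (by omega) (by omega) y hyones
          exact R.onesSpace_mono v M (by omega) h1
      by_cases hma : (m : ℤ) + -(a : ℤ) = 0
      · have hM : l.sum = M := by omega
        refine add_mem (add_mem hT1 (Submodule.smul_mem _ _ hT2)) (Submodule.smul_mem _ _ ?_)
        rw [hM] at hyones
        exact R.onesSpace_mono v M (by omega) hyones
      · rw [centralTerm_of_ne c hma, zero_smul', add_zero]
        exact add_mem hT1 (Submodule.smul_mem _ _ hT2)
  | zero => rw [map_zero]; exact zero_mem _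
  | add x y _ _ hx hy => rw [map_add]; exact add_mem hx hy
  | smul a x _ hx => rw [map_smul]; exact Submodule.smul_mem _ a hx

/-- `(r + s) • x = r • x + s • x` in `V(c,h)`. [folklore] -/
theorem add_smul' (r s : ℂ) (x : Verma c h) : (r + s) • x = r • x + s • x := add_smul r s x

/-- **The leading term of `L_{a-1}` on an ordered word** (Iohara–Koga Lemma 5.15, Step III): if
every letter `≠ 1` of the decreasing positive word `l` is `≥ a` (`a ≥ 2`), then modulo ordered
words with at most as many ones as `l`,
`L_{a-1} e_l v_{c,h} ≡ r_a (2a - 1) e_{l'} v_{c,h}`, where `r_a` is the multiplicity of `a` in `l`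
and `l'` is `l` with one letter `a` replaced by a letter `1` (`[L_{a-1}, L_{-a}] = (2a-1) L_{-1}`,
the commutators with the letters `> a` create no `L_{-1}`, and `L_{a-1}` kills ones on `L_{-1}ʲ v`).
[cite: IoharaKoga2011, Lemma 5.15 (proof, Step III and eq. (5.27))] -/
theorem L_pred_pbwVector_sub_mem (a : ℕ) (ha : 2 ≤ a) (l : List ℕ) (hs : l.Pairwise (· ≥ ·))
    (hp : ∀ k ∈ l, 0 < k) (hl : ∀ k ∈ l, k = 1 ∨ a ≤ k) :
    ∀ M : ℕ, l.sum = M + (a - 1) →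
      (rep c h).L ((a - 1 : ℕ) : ℤ) ((rep c h).pbwVector l (hw c h)) -
          ((l.count a * (2 * a - 1) : ℕ) : ℂ) •
            (rep c h).pbwVector ((l.erase a).orderedInsert (· ≥ ·) 1) (hw c h) ∈
        (rep c h).onesSpace (hw c h) M (l.count 1) := by
  induction l with
  | nil => intro M hM; simp at hM; omega
  | cons x rest ih =>
    intro M hM
    set R := rep c h
    set v := hw c h
    rw [List.pairwise_cons] at hs
    have hx : 0 < x := hp x List.mem_cons_self
    have hp' : ∀ k ∈ rest, 0 < k := fun k hk => hp k (List.mem_cons_of_mem x hk)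
    have hl' : ∀ k ∈ rest, k = 1 ∨ a ≤ k := fun k hk => hl k (List.mem_cons_of_mem x hk)
    rw [List.sum_cons] at hM
    set y := R.pbwVector rest v with hy
    have hyones : y ∈ R.onesSpace v rest.sum (rest.count 1) := R.pbwVector_mem_onesSpace v hs.2 hp' le_rfl
    have hylevel : y ∈ R.levelSpace v rest.sum := R.onesSpace_le_levelSpace v _ _ hyones
    have hscalar : ((((a - 1 : ℕ) : ℤ)) : ℂ) - (((-(a : ℤ)) : ℤ) : ℂ) = ((2 * a - 1 : ℕ) : ℂ) := by
      have h1 : 1 ≤ a := by omega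
      push_cast [Nat.cast_sub h1, Nat.cast_sub (show 1 ≤ 2 * a by omega)]
      ring
    rcases hl x List.mem_cons_self with hx1 | hax
    · -- `x = 1`: the word is `L_{-1}ʲ v`
      subst hx1
      have hrest : ∀ k ∈ rest, k = 1 := fun k hk => le_antisymm (hs.1 k hk) (hp' k hk)
      have hl1 : (1 :: rest) = List.replicate (rest.length + 1) 1 := by
        rw [List.eq_replicate_iff]
        refine ⟨by simp, fun b hb => ?_⟩
        rcases List.mem_cons.mp hb with rfl | hb
        · rfl
        · exact hrest b hb
      have hcount : (1 :: rest).count a = 0 :=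
        List.count_eq_zero.mpr fun hmem => by
          rcases List.mem_cons.mp hmem with h1 | h1
          · omega
          · have := hrest a h1; omega
      have hsum1 : 1 + rest.sum = rest.length + 1 := by
        have := congrArg List.sum hl1
        rw [List.sum_cons, List.sum_replicate_nat, mul_one] at this
        exact this
      have hcount1 : (1 :: rest).count 1 = rest.length + 1 := by
        rw [hl1, List.count_replicate_self]
      rw [hcount, zero_mul, Nat.cast_zero, zero_smul', sub_zero, hcount1, hl1]
      have h1 := L_pos_pbwVector_ones_mem (c := c) (h := h) (rest.length + 1) M (a - 1) (by omega)
        (by omega)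
      exact R.onesSpace_mono v M (by omega) h1
    · rcases eq_or_lt_of_le hax with hxa | hax'
      · -- `x = a`: `[L_{a-1}, L_{-a}] = (2a - 1) L_{-1}`
        subst hxa
        have ha1 : a ≠ 1 := by omega
        have hcount1 : (a :: rest).count 1 = rest.count 1 := by rw [List.count_cons]; simp [ha1]
        have hcounta : (a :: rest).count a = rest.count a + 1 := by simp
        rw [VirasoroRep.pbwVector_cons, R.comm_apply ((a - 1 : ℕ) : ℤ) (-(a : ℤ)) y,
          centralTerm_of_ne c (by omega : ((a - 1 : ℕ) : ℤ) + -(a : ℤ) ≠ 0), zero_smul', add_zero,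
          hscalar, show ((a - 1 : ℕ) : ℤ) + -(a : ℤ) = -((1 : ℕ) : ℤ) by omega, List.erase_cons_head,
          hcount1, hcounta]
        -- `L_{-1} y ≡ e_{rest with 1 inserted}`
        have hB : R.L (-((1 : ℕ) : ℤ)) y - R.pbwVector (rest.orderedInsert (· ≥ ·) 1) v ∈
            R.onesSpace v M (rest.count 1) := by
          have := (R.L_neg_pbwVector_sub_mem_onesSpace v rest.sum).1 rest hs.2 hp' rfl 1 one_pos
          rwa [show rest.sum + 1 = M by omega] at this
        by_cases hMa : a ≤ M
        · -- the inductive term `L_{-a} (L_{a-1} y)`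
          have hIH := ih hs.2 hp' hl' (M - a) (by omega)
          have hA := (R.L_neg_pbwVector_sub_mem_onesSpace v (M - a)).2 a (by omega) _ _ hIH
          rw [if_neg ha1, add_zero, show M - a + a = M by omega, map_sub, map_smul,
            ← VirasoroRep.pbwVector_cons] at hA
          -- the two main terms agree
          have hagree : ((rest.count a * (2 * a - 1) : ℕ) : ℂ) •
              (R.pbwVector (a :: (rest.erase a).orderedInsert (· ≥ ·) 1) v -
                R.pbwVector (rest.orderedInsert (· ≥ ·) 1) v) = 0 := by
            by_cases hmem : a ∈ rest
            · -- then `rest = a :: rest₂`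
              cases rest with
              | nil => simp at hmem
              | cons b rest₂ =>
                have hb : b = a := by
                  refine le_antisymm (hs.1 b List.mem_cons_self) ?_
                  rcases List.mem_cons.mp hmem with h1 | h1
                  · exact h1 ▸ le_rfl
                  · exact (List.pairwise_cons.mp hs.2).1 a h1
                subst hb
                rw [List.erase_cons_head, List.orderedInsert_cons, if_neg (by omega), sub_self]
                exact smul_zero (M := ℂ) (A := Verma c h) _
            · rw [List.count_eq_zero_of_not_mem hmem, zero_mul, Nat.cast_zero, zero_smul']
          have key : R.L (-(a : ℤ)) (R.L ((a - 1 : ℕ) : ℤ) y) + ((2 * a - 1 : ℕ) : ℂ) • R.L (-((1 : ℕ) : ℤ)) y -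
              (((rest.count a + 1) * (2 * a - 1) : ℕ) : ℂ) • R.pbwVector (rest.orderedInsert (· ≥ ·) 1) v =
            (R.L (-(a : ℤ)) (R.L ((a - 1 : ℕ) : ℤ) y) - ((rest.count a * (2 * a - 1) : ℕ) : ℂ) •
                R.pbwVector (a :: (rest.erase a).orderedInsert (· ≥ ·) 1) v) +
              ((2 * a - 1 : ℕ) : ℂ) • (R.L (-((1 : ℕ) : ℤ)) y - R.pbwVector (rest.orderedInsert (· ≥ ·) 1) v) +
              ((rest.count a * (2 * a - 1) : ℕ) : ℂ) •
                (R.pbwVector (a :: (rest.erase a).orderedInsert (· ≥ ·) 1) v -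
                  R.pbwVector (rest.orderedInsert (· ≥ ·) 1) v) := by
            rw [smul_sub', smul_sub', show (((rest.count a + 1) * (2 * a - 1) : ℕ) : ℂ) =
              ((rest.count a * (2 * a - 1) : ℕ) : ℂ) + ((2 * a - 1 : ℕ) : ℂ) by push_cast; ring, add_smul']
            abel
          rw [key, hagree, add_zero]
          exact add_mem hA (Submodule.smul_mem _ _ hB)
        · -- `M < a`: `L_{a-1} y = 0` and `a ∉ rest`
          have hy0 : R.L ((a - 1 : ℕ) : ℤ) y = 0 := L_pos_apply_eq_zero_of_lt (by omega) hylevel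
          have hmem : a ∉ rest := fun hmem => by
            have := List.le_sum_of_mem hmem
            omega
          rw [hy0, map_zero, zero_add, List.count_eq_zero_of_not_mem hmem, zero_add, one_mul,
            ← smul_sub']
          exact Submodule.smul_mem _ _ hB
      · -- `a < x`: `[L_{a-1}, L_{-x}]` is a multiple of `L_{-(x-a+1)}`, `x - a + 1 ≥ 2`
        have hxa : x ≠ a := by omega
        have hx1 : x ≠ 1 := by omega
        have hcount1 : (x :: rest).count 1 = rest.count 1 := by rw [List.count_cons]; simp [hx1]
        have hcounta : (x :: rest).count a = rest.count a := by rw [List.count_cons]; simp [hxa]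
        have herase : (x :: rest).erase a = x :: rest.erase a := by simp [hxa]
        rw [VirasoroRep.pbwVector_cons, R.comm_apply ((a - 1 : ℕ) : ℤ) (-(x : ℤ)) y,
          centralTerm_of_ne c (by omega : ((a - 1 : ℕ) : ℤ) + -(x : ℤ) ≠ 0), zero_smul', add_zero,
          hcount1, hcounta, herase, List.orderedInsert_cons, if_neg (by omega : ¬ (1 ≥ x)),
          VirasoroRep.pbwVector_cons, show ((a - 1 : ℕ) : ℤ) + -(x : ℤ) = -((x - a + 1 : ℕ) : ℤ) by omega]
        have hB : R.L (-((x - a + 1 : ℕ) : ℤ)) y ∈ R.onesSpace v M (rest.count 1) := by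
          have := (R.L_neg_pbwVector_sub_mem_onesSpace v rest.sum).2 (x - a + 1) (by omega) _ _ hyones
          rwa [if_neg (by omega : x - a + 1 ≠ 1), add_zero,
            show rest.sum + (x - a + 1) = M by omega] at this
        by_cases hMx : x ≤ M
        · have hIH := ih hs.2 hp' hl' (M - x) (by omega)
          have hA := (R.L_neg_pbwVector_sub_mem_onesSpace v (M - x)).2 x hx _ _ hIH
          rw [if_neg hx1, add_zero, show M - x + x = M by omega, map_sub, map_smul] at hA
          have := add_mem hA (Submodule.smul_mem _
            (((((a - 1 : ℕ) : ℤ)) : ℂ) - (((-(x : ℤ)) : ℤ) : ℂ)) hB)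
          convert this using 1
          abel
        · have hy0 : R.L ((a - 1 : ℕ) : ℤ) y = 0 := L_pos_apply_eq_zero_of_lt (by omega) hylevel
          have hmem : a ∉ rest := fun hmem => by
            have := List.le_sum_of_mem hmem
            omega
          rw [hy0, map_zero, zero_add, List.count_eq_zero_of_not_mem hmem, zero_mul, Nat.cast_zero,
            zero_smul', sub_zero]
          exact Submodule.smul_mem _ _ hB

/-! ### Uniqueness of singular vectors -/

/-- The decreasing word of a partition. [folklore] -/
def lst {n : ℕ} (K : Nat.Partition n) : List ℕ := (K.parts.sort (· ≤ ·)).reverse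

/-- Properties of the decreasing word of a partition. [folklore] -/
theorem lst_props {n : ℕ} (K : Nat.Partition n) :
    (lst K).Pairwise (· ≥ ·) ∧ (∀ j ∈ lst K, 0 < j) ∧ (lst K).sum = n ∧
      ((lst K : List ℕ) : Multiset ℕ) = K.parts ∧
      (rep c h).partitionVector K (hw c h) = (rep c h).pbwVector (lst K) (hw c h) := by
  refine ⟨?_, ?_, ?_, ?_, rfl⟩
  · exact List.pairwise_reverse.mpr (Multiset.pairwise_sort K.parts (· ≤ ·))
  · intro j hj
    rw [lst, List.mem_reverse, Multiset.mem_sort] at hj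
    exact K.parts_pos hj
  · rw [lst, List.sum_reverse, ← Multiset.sum_coe, Multiset.sort_eq, K.parts_sum]
  · rw [lst, Multiset.coe_reverse, Multiset.sort_eq]

/-- The partition `(1ⁿ)`, whose PBW monomial is `L_{-1}ⁿ v_{c,h}`. [cite: IoharaKoga2011, §5.2.1 (𝕀₀ = (1ⁿ))] -/
def onesPartition (n : ℕ) : Nat.Partition n where
  parts := Multiset.replicate n 1
  parts_pos hi := by rw [Multiset.eq_of_mem_replicate hi]; exact one_pos
  parts_sum := by simp

/-- A partition all of whose parts are `1` is `(1ⁿ)`. [folklore] -/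
theorem eq_onesPartition_of_forall {n : ℕ} (K : Nat.Partition n) (hK : ∀ p ∈ K.parts, p = 1) :
    K = onesPartition n := by
  refine Nat.Partition.ext ?_
  show K.parts = Multiset.replicate n 1
  have h1 : K.parts = Multiset.replicate (Multiset.card K.parts) 1 := Multiset.eq_replicate.mpr ⟨rfl, hK⟩
  have h2 : Multiset.card K.parts = n := by
    have hs := congrArg Multiset.sum h1
    rw [K.parts_sum, Multiset.sum_replicate, smul_eq_mul, mul_one] at hs
    exact hs.symm
  rw [h1, h2]

/-- The ones filtration of `V(c,h)` is spanned by PBW monomials with at most `r` parts equal to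
`1`. [folklore] -/
theorem onesSpace_le_span {M r : ℕ} :
    (rep c h).onesSpace (hw c h) M r ≤
      Submodule.span ℂ ((fun P : Nat.Partition M => (rep c h).partitionVector P (hw c h)) ''
        {P | P.parts.count 1 ≤ r}) := by
  refine Submodule.span_le.mpr ?_
  rintro _ ⟨l, hs, hp, hsum, hr, rfl⟩
  obtain ⟨P, hP, hPl⟩ := (rep c h).pbwVector_eq_partitionVector (hw c h) hs hp hsum
  rw [hPl]
  refine Submodule.subset_span ⟨P, ?_, rfl⟩
  show P.parts.count 1 ≤ r
  rw [← hP, Multiset.coe_count]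
  exact hr

/-- **Uniqueness of singular vectors, coefficient form** (Iohara–Koga Proposition 5.1 / (5.28)):
a non-zero vector of `V(c,h)` killed by all `L_m`, `m ≥ 1`, does not lie in the span of the PBW
monomials `e_𝕂 v_{c,h}`, `𝕂 ⊢ n`, `𝕂 ≠ (1ⁿ)` — its coefficient on `L_{-1}ⁿ v_{c,h}` is non-zero.
[cite: IoharaKoga2011, Proposition 5.1 and Lemma 5.15] -/
theorem singular_not_mem_span_ne_ones {n : ℕ} {w : Verma c h}
    (hsing : ∀ m : ℕ, 1 ≤ m → (rep c h).L m w = 0) (hw0 : w ≠ 0) :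
    w ∉ Submodule.span ℂ ((fun K : Nat.Partition n => (rep c h).partitionVector K (hw c h)) ''
      {K | K ≠ onesPartition n}) := by
  classical
  intro hmem
  set R := rep c h with hR
  set v := hw c h with hv
  -- coordinates supported away from `(1ⁿ)`
  obtain ⟨cf, hcf, hsum⟩ := (Finsupp.mem_span_image_iff_linearCombination ℂ).mp hmem
  rw [Finsupp.mem_supported] at hcf
  have hw : w = ∑ K, cf K • R.partitionVector K v := by
    rw [← hsum, Finsupp.linearCombination_apply, Finsupp.sum_fintype]
    exact fun K => zero_smul' _
  let T : Finset (Nat.Partition n) := cf.support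
  have hT : T.Nonempty := by
    rw [Finsupp.support_nonempty_iff]
    intro h0
    apply hw0
    rw [hw, h0]
    exact Finset.sum_eq_zero fun K _ => by rw [Finsupp.zero_apply, zero_smul']
  -- the largest number of ones
  let k₀ : ℕ := T.sup fun K => K.parts.count 1
  have hle : ∀ K, cf K ≠ 0 → K.parts.count 1 ≤ k₀ := fun K hK =>
    Finset.le_sup (f := fun K : Nat.Partition n => K.parts.count 1) (Finsupp.mem_support_iff.mpr hK)
  let U : Finset (Nat.Partition n) := T.filter fun K => K.parts.count 1 = k₀
  have hU : U.Nonempty := by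
    obtain ⟨K, hK, hKeq⟩ := Finset.exists_mem_eq_sup T hT fun K => K.parts.count 1
    exact ⟨K, Finset.mem_filter.mpr ⟨hK, hKeq.symm⟩⟩
  have hUcf : ∀ K ∈ U, cf K ≠ 0 := fun K hK => Finsupp.mem_support_iff.mp (Finset.mem_filter.mp hK).1
  have hUne : ∀ K ∈ U, K ≠ onesPartition n := fun K hK => hcf (by
    show K ∈ (cf.support : Set (Nat.Partition n)); exact (Finset.mem_filter.mp hK).1)
  -- the least part `≠ 1` among the monomials of `U`
  let S₂ : Finset ℕ := U.biUnion fun K => (K.parts.filter fun p => p ≠ 1).toFinset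
  have hS₂ : S₂.Nonempty := by
    obtain ⟨K, hK⟩ := hU
    have : ∃ p ∈ K.parts, p ≠ 1 := by
      by_contra hall
      push Not at hall
      exact hUne K hK (eq_onesPartition_of_forall K hall)
    obtain ⟨p, hp, hp1⟩ := this
    exact ⟨p, Finset.mem_biUnion.mpr ⟨K, hK, by simp [hp, hp1]⟩⟩
  set a : ℕ := S₂.min' hS₂ with ha_def
  have ha_mem : a ∈ S₂ := Finset.min'_mem S₂ hS₂
  obtain ⟨K₀, hK₀U, hK₀a⟩ := Finset.mem_biUnion.mp ha_mem
  simp only [Multiset.mem_toFinset, Multiset.mem_filter] at hK₀a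
  have ha2 : 2 ≤ a := by
    have := K₀.parts_pos hK₀a.1
    omega
  have han : a ≤ n := Nat.Partition.le_of_mem_parts hK₀a.1
  have hmin : ∀ K ∈ U, ∀ p ∈ K.parts, p ≠ 1 → a ≤ p := fun K hK p hp hp1 =>
    Finset.min'_le S₂ p (Finset.mem_biUnion.mpr ⟨K, hK, by simp [hp, hp1]⟩)
  -- the level after applying `L_{a-1}`
  set M : ℕ := n + 1 - a with hM_def
  have hnM : n = M + (a - 1) := by omega
  -- apply `L_{a-1}` to `w`
  have hLw : ∑ K ∈ T, cf K • R.L ((a - 1 : ℕ) : ℤ) (R.partitionVector K v) = 0 := by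
    have := hsing (a - 1) (by omega)
    rw [hw, map_sum] at this
    rw [← this, ← Finset.sum_subset (Finset.subset_univ T)]
    · refine Finset.sum_congr rfl fun K _ => ?_
      rw [map_smul]
    · intro K _ hK
      rw [Finsupp.notMem_support_iff.mp hK, zero_smul', map_zero]
  -- the main terms
  let coef : Nat.Partition n → ℕ := fun K => (lst K).count a * (2 * a - 1)
  let mt : Nat.Partition n → Verma c h := fun K =>
    ((coef K : ℕ) : ℂ) • R.pbwVector (((lst K).erase a).orderedInsert (· ≥ ·) 1) v
  -- all terms lie in the ones filtration, except the main terms of `U`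
  have hOS : ∑ K ∈ U, cf K • mt K ∈ R.onesSpace v M k₀ := by
    have hsplit : ∑ K ∈ T, cf K • R.L ((a - 1 : ℕ) : ℤ) (R.partitionVector K v) =
        ∑ K ∈ U, cf K • R.L ((a - 1 : ℕ) : ℤ) (R.partitionVector K v) +
          ∑ K ∈ T.filter (fun K => ¬ K.parts.count 1 = k₀),
            cf K • R.L ((a - 1 : ℕ) : ℤ) (R.partitionVector K v) :=
      (Finset.sum_filter_add_sum_filter_not T (fun K => K.parts.count 1 = k₀) _).symm
    -- the non-top terms
    have hlow : ∑ K ∈ T.filter (fun K => ¬ K.parts.count 1 = k₀),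
        cf K • R.L ((a - 1 : ℕ) : ℤ) (R.partitionVector K v) ∈ R.onesSpace v M k₀ := by
      refine Submodule.sum_mem _ fun K hK => Submodule.smul_mem _ _ ?_
      obtain ⟨hKT, hKne⟩ := Finset.mem_filter.mp hK
      have hlt : K.parts.count 1 < k₀ :=
        lt_of_le_of_ne (hle K (Finsupp.mem_support_iff.mp hKT)) hKne
      obtain ⟨hs, hp, hsum', hcoe, hKl⟩ := lst_props (c := c) (h := h) K
      rw [hKl]
      have h1 := L_pos_mem_onesSpace (c := c) (h := h) n M (a - 1) (K.parts.count 1) (by omega)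
        (by omega) _ (by
          have := R.pbwVector_mem_onesSpace v hs hp (r := K.parts.count 1)
            (by rw [← hcoe, Multiset.coe_count])
          rwa [hsum'] at this)
      exact R.onesSpace_mono v M (by omega) h1
    -- the top terms minus their main terms
    have htop : ∑ K ∈ U, cf K • (R.L ((a - 1 : ℕ) : ℤ) (R.partitionVector K v) - mt K) ∈
        R.onesSpace v M k₀ := by
      refine Submodule.sum_mem _ fun K hK => Submodule.smul_mem _ _ ?_
      obtain ⟨hs, hp, hsum', hcoe, hKl⟩ := lst_props (c := c) (h := h) K
      have hK1 : (lst K).count 1 = k₀ := by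
        rw [← Multiset.coe_count, hcoe]
        exact (Finset.mem_filter.mp hK).2
      have hKa : ∀ k ∈ lst K, k = 1 ∨ a ≤ k := by
        intro k hk
        have hk' : k ∈ K.parts := by rw [← hcoe]; exact hk
        by_cases hk1 : k = 1
        · exact Or.inl hk1
        · exact Or.inr (hmin K hK k hk' hk1)
      rw [hKl, ← hK1]
      exact L_pred_pbwVector_sub_mem a ha2 (lst K) hs hp hKa M (by rw [hsum']; exact hnM)
    have hsum2 : ∑ K ∈ U, cf K • mt K +
        ∑ K ∈ U, cf K • (R.L ((a - 1 : ℕ) : ℤ) (R.partitionVector K v) - mt K) =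
        ∑ K ∈ U, cf K • R.L ((a - 1 : ℕ) : ℤ) (R.partitionVector K v) := by
      rw [← Finset.sum_add_distrib]
      refine Finset.sum_congr rfl fun K _ => ?_
      rw [smul_sub']
      abel
    have h0 : ∑ K ∈ U, cf K • R.L ((a - 1 : ℕ) : ℤ) (R.partitionVector K v) +
        ∑ K ∈ T.filter (fun K => ¬ K.parts.count 1 = k₀),
          cf K • R.L ((a - 1 : ℕ) : ℤ) (R.partitionVector K v) = 0 := by
      rw [← hsplit]; exact hLw
    have key : ∑ K ∈ U, cf K • mt K =
        -(∑ K ∈ U, cf K • (R.L ((a - 1 : ℕ) : ℤ) (R.partitionVector K v) - mt K)) -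
          ∑ K ∈ T.filter (fun K => ¬ K.parts.count 1 = k₀),
            cf K • R.L ((a - 1 : ℕ) : ℤ) (R.partitionVector K v) := by
      rw [eq_sub_of_add_eq hsum2, eq_neg_of_add_eq_zero_left h0]
      abel
    rw [key]
    exact Submodule.sub_mem _ (Submodule.neg_mem _ htop) hlow
  -- restrict to the monomials containing `a`
  let U' : Finset (Nat.Partition n) := U.filter fun K => a ∈ K.parts
  have hU'sum : ∑ K ∈ U, cf K • mt K = ∑ K ∈ U', cf K • mt K := by
    conv_rhs => rw [Finset.sum_filter]
    refine Finset.sum_congr rfl fun K hK => ?_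
    split_ifs with hKa
    · rfl
    · have : (lst K).count a = 0 := by
        rw [← Multiset.coe_count, (lst_props (c := c) (h := h) K).2.2.2.1]
        exact Multiset.count_eq_zero.mpr hKa
      simp only [mt, coef, this, zero_mul, Nat.cast_zero, zero_smul']
      exact smul_zero (M := ℂ) (A := Verma c h) _
  -- the partition `K - (a) + (1)` of `M`
  have hsumM : ∀ K : Nat.Partition n, a ∈ K.parts → (1 ::ₘ K.parts.erase a).sum = M := by
    intro K hKa
    have h1 := Multiset.sum_erase hKa
    rw [K.parts_sum] at h1
    rw [Multiset.sum_cons]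
    omega
  let Pf : Nat.Partition n → Nat.Partition M := fun K =>
    if hKa : a ∈ K.parts then
      ⟨1 ::ₘ K.parts.erase a, fun hi => by
        rcases Multiset.mem_cons.mp hi with h1 | h1
        · omega
        · exact K.parts_pos (Multiset.mem_of_mem_erase h1), hsumM K hKa⟩
    else onesPartition M
  have hPf_parts : ∀ K, a ∈ K.parts → (Pf K).parts = 1 ::ₘ K.parts.erase a := by
    intro K hKa
    simp only [Pf, dif_pos hKa]
  have hPf_vec : ∀ K ∈ U', R.pbwVector (((lst K).erase a).orderedInsert (· ≥ ·) 1) v =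
      R.partitionVector (Pf K) v := by
    intro K hK
    have hKa : a ∈ K.parts := (Finset.mem_filter.mp hK).2
    obtain ⟨hs, hp, hsum', hcoe, -⟩ := lst_props (c := c) (h := h) K
    have hs' : ((lst K).erase a).Pairwise (· ≥ ·) := hs.sublist (List.erase_sublist)
    have hp' : ∀ j ∈ (lst K).erase a, 0 < j := fun j hj => hp j (List.erase_subset hj)
    obtain ⟨hs'', hp'', hsum'', -⟩ := VirasoroRep.orderedInsert_props hs' hp' one_pos
    have hcoe' : ((((lst K).erase a).orderedInsert (· ≥ ·) 1 : List ℕ) : Multiset ℕ) =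
        1 ::ₘ K.parts.erase a := by
      rw [Multiset.coe_eq_coe.mpr (List.perm_orderedInsert _ _ _), ← Multiset.cons_coe,
        ← Multiset.coe_erase, hcoe]
    have hsumM' : (((lst K).erase a).orderedInsert (· ≥ ·) 1).sum = M := by
      rw [← Multiset.sum_coe, hcoe']
      exact hsumM K hKa
    obtain ⟨Q, hQ, hQv⟩ := R.pbwVector_eq_partitionVector v hs'' hp'' hsumM'
    rw [hQv]
    congr 1
    exact Nat.Partition.ext (by rw [← hQ, hcoe', hPf_parts K hKa])
  have hPf_inj : ∀ K ∈ U', ∀ K' ∈ U', Pf K = Pf K' → K = K' := by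
    intro K hK K' hK' hKK'
    have hKa : a ∈ K.parts := (Finset.mem_filter.mp hK).2
    have hKa' : a ∈ K'.parts := (Finset.mem_filter.mp hK').2
    have := congrArg Nat.Partition.parts hKK'
    rw [hPf_parts K hKa, hPf_parts K' hKa', Multiset.cons_inj_right] at this
    exact Nat.Partition.ext (by rw [← Multiset.cons_erase hKa, ← Multiset.cons_erase hKa', this])
  -- regroup by the value of `Pf`
  let d : Nat.Partition M → ℂ := fun P => ∑ K ∈ U', if Pf K = P then cf K * coef K else 0
  have hregroup : ∑ K ∈ U', cf K • mt K = ∑ P, d P • R.partitionVector P v := by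
    symm
    calc ∑ P, d P • R.partitionVector P v
        = ∑ P, ∑ K ∈ U', (if Pf K = P then cf K * coef K else 0) • R.partitionVector P v := by
          refine Finset.sum_congr rfl fun P _ => ?_
          rw [sum_smul']
      _ = ∑ K ∈ U', ∑ P, (if Pf K = P then cf K * coef K else 0) • R.partitionVector P v := Finset.sum_comm
      _ = ∑ K ∈ U', cf K • mt K := by
          refine Finset.sum_congr rfl fun K hK => ?_
          simp only [ite_zero_smul', Finset.sum_ite_eq, Finset.mem_univ, if_true]
          rw [mul_smul', ← hPf_vec K hK]
  have hd : ∀ P, d P ≠ 0 → ¬ P.parts.count 1 ≤ k₀ := by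
    intro P hP
    obtain ⟨K, hK, hK'⟩ := Finset.exists_ne_zero_of_sum_ne_zero hP
    have hPK : Pf K = P := by by_contra hne; exact hK' (if_neg hne)
    have hKa : a ∈ K.parts := (Finset.mem_filter.mp hK).2
    have hKU : K ∈ U := (Finset.mem_filter.mp hK).1
    rw [← hPK, hPf_parts K hKa, Multiset.count_cons_self,
      Multiset.count_erase_of_ne (by omega : (1 : ℕ) ≠ a), (Finset.mem_filter.mp hKU).2]
    omega
  have hmemspan : ∑ P, d P • R.partitionVector P v ∈
      Submodule.span ℂ ((fun P : Nat.Partition M => R.partitionVector P v) '' {P | P.parts.count 1 ≤ k₀}) := by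
    rw [← hregroup, ← hU'sum]
    exact onesSpace_le_span hOS
  have hdz := coeff_eq_zero_of_mem_span_image (fun P : Nat.Partition M => P.parts.count 1 ≤ k₀) d hd hmemspan
  -- but the coefficient at `Pf K₀` is `cf K₀ · r_a(K₀) (2a - 1) ≠ 0`
  have hK₀U' : K₀ ∈ U' := Finset.mem_filter.mpr ⟨hK₀U, hK₀a.1⟩
  have hdK₀ : d (Pf K₀) = cf K₀ * coef K₀ := by
    simp only [d]
    rw [Finset.sum_eq_single_of_mem K₀ hK₀U' fun K hK hne => if_neg fun heq => hne (hPf_inj K hK K₀ hK₀U' heq),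
      if_pos rfl]
  have hcoef : coef K₀ ≠ 0 := by
    have hcount : 0 < (lst K₀).count a := by
      rw [← Multiset.coe_count, (lst_props (c := c) (h := h) K₀).2.2.2.1]
      exact Multiset.count_pos.mpr hK₀a.1
    simp only [coef]
    exact Nat.mul_ne_zero (by omega) (by omega)
  have := hdz (Pf K₀)
  rw [hdK₀] at this
  exact mul_ne_zero (hUcf K₀ hK₀U) (Nat.cast_ne_zero.mpr hcoef) this

/-- **Uniqueness of singular vectors** (Iohara–Koga Proposition 5.1:
`dim {M(c,h)_{h+n}}^{𝔤⁺} ≤ 1`): two vectors of the weight space `V(c,h)_{h+n}` killed by all `L_m`,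
`m ≥ 1`, are proportional (as soon as one of them is non-zero). [cite: IoharaKoga2011, Proposition 5.1] -/
theorem exists_smul_eq_of_singular {n : ℕ} {w₁ w₂ : Verma c h}
    (hw₁ : w₁ ∈ (rep c h).levelSpace (hw c h) n) (hw₂ : w₂ ∈ (rep c h).levelSpace (hw c h) n)
    (hs₁ : ∀ m : ℕ, 1 ≤ m → (rep c h).L m w₁ = 0) (hs₂ : ∀ m : ℕ, 1 ≤ m → (rep c h).L m w₂ = 0)
    (hw₁0 : w₁ ≠ 0) : ∃ t : ℂ, w₂ = t • w₁ := by
  classical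
  set R := rep c h
  set v := hw c h
  obtain ⟨c₁, hc₁⟩ := (Submodule.mem_span_range_iff_exists_fun ℂ).mp hw₁
  obtain ⟨c₂, hc₂⟩ := (Submodule.mem_span_range_iff_exists_fun ℂ).mp hw₂
  -- a combination with vanishing `(1ⁿ)`-coefficient lies in the forbidden span
  have hspan : ∀ e : Nat.Partition n → ℂ, e (onesPartition n) = 0 →
      ∑ K, e K • R.partitionVector K v ∈
        Submodule.span ℂ ((fun K : Nat.Partition n => R.partitionVector K v) '' {K | K ≠ onesPartition n}) := by
    intro e he
    refine Submodule.sum_mem _ fun K _ => ?_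
    by_cases hK : K = onesPartition n
    · rw [hK, he, zero_smul']; exact zero_mem _
    · exact Submodule.smul_mem _ _ (Submodule.subset_span ⟨K, hK, rfl⟩)
  -- the `(1ⁿ)`-coefficient of `w₁` is non-zero
  have h₁ : c₁ (onesPartition n) ≠ 0 := by
    intro h0
    exact singular_not_mem_span_ne_ones hs₁ hw₁0 (hc₁ ▸ hspan c₁ h0)
  refine ⟨c₂ (onesPartition n) / c₁ (onesPartition n), ?_⟩
  set t := c₂ (onesPartition n) / c₁ (onesPartition n) with ht
  -- `w₂ - t w₁` is singular with vanishing `(1ⁿ)`-coefficient, hence zero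
  have hu : w₂ - t • w₁ = ∑ K, (c₂ K - t * c₁ K) • R.partitionVector K v := by
    rw [← hc₁, ← hc₂, smul_sum', ← Finset.sum_sub_distrib]
    refine Finset.sum_congr rfl fun K _ => ?_
    rw [sub_smul', mul_smul']
  have husing : ∀ m : ℕ, 1 ≤ m → R.L m (w₂ - t • w₁) = 0 := fun m hm => by
    rw [map_sub, map_smul, hs₁ m hm, hs₂ m hm]
    exact sub_eq_zero.mpr (smul_zero (M := ℂ) (A := Verma c h) t).symm
  by_contra hne
  have hne' : w₂ - t • w₁ ≠ 0 := fun h0 => hne (sub_eq_zero.mp h0)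
  refine singular_not_mem_span_ne_ones (n := n) husing hne' ?_
  rw [hu]
  refine hspan _ ?_
  rw [ht, div_mul_cancel₀ _ h₁, sub_self]

/-- **The submodule generated by the primary vectors of weight `h + n` is generated by any
non-zero one of them** (`n ≥ 0`; by uniqueness of singular vectors). [cite: IoharaKoga2011, Proposition 5.1 and Corollary 5.2] -/
theorem primarySpan_eq_generated {n : ℕ} {w : Verma c h} (hw0 : w ≠ 0)
    (hprim : (rep c h).IsPrimary w (h + n)) :
    (rep c h).primarySpan (h + n) = (rep c h).generated {w} := by
  apply le_antisymm
  · refine (rep c h).generated_le (fun w' hw' => ?_) ((rep c h).isInvariant_generated _)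
    have hlev : ∀ {u : Verma c h}, (rep c h).IsPrimary u (h + n) → u ∈ (rep c h).levelSpace (hw c h) n :=
      fun hu => by
        rw [← (rep c h).weightSpace_eq_levelSpace isPrimary_hw generated_hw_eq_top n]
        exact hu.mem_weightSpace
    obtain ⟨t, rfl⟩ := exists_smul_eq_of_singular (hlev hprim) (hlev hw')
      (fun m hm => hprim.annihilated m (by exact_mod_cast hm))
      (fun m hm => hw'.annihilated m (by exact_mod_cast hm)) hw0
    exact Submodule.smul_mem _ t ((rep c h).subset_generated {w} (Set.mem_singleton w))
  · exact (rep c h).generated_mono (Set.singleton_subset_iff.mpr hprim)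

end Verma

end Literature.RepresentationTheory.Virasoro

end
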